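import Summits.BirchSwinnertonDyer.BirchSwinnertonDyer.Theses.PrintX8VS
import Summits.BirchSwinnertonDyer.BirchSwinnertonDyer.Theorems.ConjSpanGenAllLevels
import Summits.BirchSwinnertonDyer.BirchSwinnertonDyer.Theorems.PrintX8VSGlue
import HarnessLib

/-!
# Route `PrintX8VS`, glue item `GlueConjSpanGenAllOfPrint` (stmt-BirchSwinnertonDyer-22564):
# (L) Morris 2007 Thm. 6.1 (2) → (C) Serre 1970 §2.6 Cor. 3 → `ConjSpanGenAll` (THEOREM B), PROVED by name;
# hence the crux `ConjSpanGenAll` (21705) is DERIVED modulo its two held printed inputs, and the X8 leaf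
# follows from K1 + held/published items of the sister route alone (cell `bsd-print-x8`, seat p3 gen 4)

HONEST FRAMING: one-line re-plumbing of bsd-f3-mu-an g5's THEOREM B as landed by p4 g2
(`ConjSpanGenAllLevels.conjSpanGenAll_of_morris_of_serre`, p571570; inputs typed by ty2 g6: (L)
`Morris2007.thm61_2_elementary_boundedlyGenerates` p564727 = item 22562 `InputBoundedGenerationAway`, (C)
`SerreSL2Congruence1970_congruenceSubgroupProperty_away` p564307 = item 22563 `InputCongruenceAway`; bridge
p566143). `PrintX8VS.ConjSpanGenAll` and `ConjSpanGenAllLevels.ConjSpanGenAll` have the same body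
(`∀ N p, p.Prime → ¬ p ∣ N → ConjSpanGen N p`), so the glue is definitional. No census cell moves;
PARTITION 0; BSD is not proved by any of this; «beyond-print theorem: NO» (the beyond-print content is
THEOREM B itself, credited to its author). After this item the sister route's unprinted residual is K1
`SprungLowerDivisibilityAtThree` (19875) alone, next to the HELD inputs 22562, 22563, 20771/20772, 20403
and GZK 19921 (`wAllCornerX8_of_K1_of_inputs`).

References: [Morris2007] Thm. 6.1 (2); [SerreSL2Congruence1970] §2.6 Thm. 2 (b), Cor. 3;
[Vaserstein1972SL2]; [Miller2011LMS] Def. 1.1; route file `Theses/PrintX8VS.lean` rev 1.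
-/

set_option autoImplicit false
-- justification: the mandated namespace `Summit.BirchSwinnertonDyer.BirchSwinnertonDyer.Theorems`
-- (single-conjunct summit, Sub = Summit) repeats a segment by design (D-0017).
set_option linter.dupNamespace false

noncomputable section

namespace Summit.BirchSwinnertonDyer.BirchSwinnertonDyer.Theorems.PrintX8VSGlue

open Summit.BirchSwinnertonDyer.BirchSwinnertonDyer.Theorems
  Summit.BirchSwinnertonDyer.BirchSwinnertonDyer.Theses

/-- **Item 22564 `PrintX8VS.GlueConjSpanGenAllOfPrint` (`InputBoundedGenerationAway → InputCongruenceAway →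
ConjSpanGenAll`), PROVED** — THEOREM B modulo its two printed inputs, by name:
`ConjSpanGenAllLevels.conjSpanGenAll_of_morris_of_serre` (bsd-f3-mu-an g5 / p4 g2 p571570; (L)+(C) ⟹ (V)
`G(A,NA) ≤ E(A,NA)` over `A = ℤ[1/p]` by ty2 g6's `SL2Rel.relG_top_span_le_relE_of_morris_of_serre`, then
the orbit trick in `Γ₀(N; ℤ[1/p])`). [cite: Morris2007, Thm. 6.1 (2)]
[cite: SerreSL2Congruence1970, §2.6 Thm. 2 (b) and Cor. 3] -/
theorem glueConjSpanGenAllOfPrint_holds : PrintX8VS.GlueConjSpanGenAllOfPrint :=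
  fun hL hC ↦ ConjSpanGenAllLevels.conjSpanGenAll_of_morris_of_serre hL hC

/-- **The crux `ConjSpanGenAll` (21705) from its two held input items**, by the glue just proved.
[cite: Morris2007, Thm. 6.1 (2)] [cite: SerreSL2Congruence1970, §2.6 Cor. 3] -/
theorem conjSpanGenAll_of_inputs (hL : PrintX8VS.InputBoundedGenerationAway)
    (hC : PrintX8VS.InputCongruenceAway) : PrintX8VS.ConjSpanGenAll :=
  glueConjSpanGenAllOfPrint_holds hL hC

/-- **The X8 leaf from the sister route's RESIDUAL K1 and its HELD/PUBLISHED input items only, in one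
theorem** (= `PrintX8VS.closes` with every provable-now glue/assembly item discharged by this file and
`PrintX8VSGlue.lean` p570406): K1 `SprungLowerDivisibilityAtThree` (19875, OPEN IN PRINT at `a₃ = ±3`),
(L) 22562, (C) 22563, the Coleman–Kato/period input 20771, the published bundle 20403 and GZK 19921 give
`WAllCornerX8`. [cite: Miller2011LMS, §1 and Def. 1.1] [cite: Morris2007, Thm. 6.1 (2)]
[cite: SerreSL2Congruence1970, §2.6 Cor. 3] -/
theorem wAllCornerX8_of_K1_of_inputs (hK1 : PrintX8VS.SprungLowerDivisibilityAtThree)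
    (hL : PrintX8VS.InputBoundedGenerationAway) (hC : PrintX8VS.InputCongruenceAway)
    (hIn : PrintX8VS.InputSharpFlatMuTransfer) (hPub : PrintX8VS.PublishedInputsX8)
    (hGZK : PrintX8VS.RankEqAnalyticRankLeOne) : Summit.BirchSwinnertonDyer.WAllCornerX8 :=
  wAllCornerX8_of_K1_of_conjSpanGenAll hK1 (conjSpanGenAll_of_inputs hL hC) hIn hPub hGZK

end Summit.BirchSwinnertonDyer.BirchSwinnertonDyer.Theorems.PrintX8VSGlue

end
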